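import Mathlib

/-!
# The parity lemma for closed dual walks on ℤ² (pub-perc-repro0, P9 Lemma 2.1)

Combinatorial core of block P of the cell pub-perc-repro0 (proofs/P9-separation-p1-v1.md, Lemma 2.1).

* A nearest-neighbour edge of `ℤ²` is `Edge.h i j = {(i,j),(i+1,j)}` (horizontal) or
  `Edge.v i j = {(i,j),(i,j+1)}` (vertical).
* A dual vertex is a pair `(a,b) : ℤ × ℤ` standing for the face centre `(a+½, b+½)`.
  Two dual vertices are adjacent when they differ by a unit step; the dual edge between them
  crosses exactly one primal edge (`crossed`): the step `(a,b) → (a,b+1)` crosses `h a (b+1)`,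
  the step `(a,b) → (a+1,b)` crosses `v (a+1) b`, and the reversed steps cross the same edges.
* `C : Finset Edge` is *even* (`IsEvenSet`) if every vertex of `ℤ²` is an endpoint of an even
  number of edges of `C` (e.g. the edge set of a cycle).

Main theorem `parity_closed_walk`: a closed dual walk crosses an even edge set an even number of
times (crossings counted with multiplicity along the walk).  The proof is the one of the paper
file: the potential `colCount C (a,b)` = number of edges `h a y`, `y ≤ b`, in `C`, satisfies
`colCount f + colCount g + [crossed edge ∈ C] ≡ 0 (mod 2)` across every dual step (`star`),
the horizontal steps by a double count over the half-column below the step (`even_bdryCount`),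
and the sum telescopes along a closed walk.

Nothing here depends on probability; the file imports Mathlib only.
-/

namespace Summit.Ventures.PercRepro0.Parity

/-- A nearest-neighbour edge of `ℤ²`: `h i j = {(i,j),(i+1,j)}`, `v i j = {(i,j),(i,j+1)}`. -/
inductive Edge
  | h (i j : ℤ)
  | v (i j : ℤ)
  deriving DecidableEq

namespace Edge

/-- The first endpoint of an edge. -/
def src : Edge → ℤ × ℤ
  | h i j => (i, j)
  | v i j => (i, j)

/-- The second endpoint of an edge. -/
def tgt : Edge → ℤ × ℤ
  | h i j => (i + 1, j)
  | v i j => (i, j + 1)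

/-- The two endpoints of an edge are distinct. -/
theorem src_ne_tgt (e : Edge) : e.src ≠ e.tgt := by
  cases e <;> simp [src, tgt]

/-- `x` is an endpoint of `e`. -/
def Incident (e : Edge) (x : ℤ × ℤ) : Prop := e.src = x ∨ e.tgt = x

/-- Incidence is decidable (it is a disjunction of two equalities in `ℤ × ℤ`). -/
instance (e : Edge) : DecidablePred e.Incident := fun x =>
  inferInstanceAs (Decidable (e.src = x ∨ e.tgt = x))

end Edge

/-- The degree of the vertex `x` in the finite edge set `C`. -/
def deg (C : Finset Edge) (x : ℤ × ℤ) : ℕ := (C.filter (fun (e : Edge) => e.Incident x)).card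

/-- `C` is even: every vertex of `ℤ²` has even degree in `C`. -/
def IsEvenSet (C : Finset Edge) : Prop := ∀ x, Even (deg C x)

/-- The number of edges of `C` with exactly one endpoint in the vertex set `S`. -/
def bdryCount (C : Finset Edge) (S : ℤ × ℤ → Prop) [DecidablePred S] : ℕ :=
  (C.filter (fun (e : Edge) => Xor (S e.src) (S e.tgt))).card

/-- The vertices of `C` lying in `S` (a finite set). -/
def verts (C : Finset Edge) (S : ℤ × ℤ → Prop) [DecidablePred S] : Finset (ℤ × ℤ) :=
  (C.biUnion (fun (e : Edge) => {e.src, e.tgt})).filter S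

/-- The first endpoint of an edge of `C` lies in `verts C S` iff it lies in `S`. -/
theorem src_mem_verts {C : Finset Edge} {S : ℤ × ℤ → Prop} [DecidablePred S] {e : Edge}
    (he : e ∈ C) : e.src ∈ verts C S ↔ S e.src := by
  simp only [verts, Finset.mem_filter, Finset.mem_biUnion, Finset.mem_insert, Finset.mem_singleton]
  exact ⟨fun h => h.2, fun h => ⟨⟨e, he, Or.inl rfl⟩, h⟩⟩

/-- The second endpoint of an edge of `C` lies in `verts C S` iff it lies in `S`. -/
theorem tgt_mem_verts {C : Finset Edge} {S : ℤ × ℤ → Prop} [DecidablePred S] {e : Edge}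
    (he : e ∈ C) : e.tgt ∈ verts C S ↔ S e.tgt := by
  simp only [verts, Finset.mem_filter, Finset.mem_biUnion, Finset.mem_insert, Finset.mem_singleton]
  exact ⟨fun h => h.2, fun h => ⟨⟨e, he, Or.inr rfl⟩, h⟩⟩

/-- For an edge `e` of `C`, the number of vertices of `verts C S` incident to `e` is the number of
endpoints of `e` in `S`. -/
theorem sum_incident_verts (C : Finset Edge) (S : ℤ × ℤ → Prop) [DecidablePred S] {e : Edge}
    (he : e ∈ C) :
    ∑ x ∈ verts C S, (if e.Incident x then 1 else 0)
      = (if S e.src then 1 else 0) + (if S e.tgt then 1 else 0) := by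
  have hpt : ∀ x, (if e.Incident x then (1 : ℕ) else 0)
      = (if e.src = x then 1 else 0) + (if e.tgt = x then 1 else 0) := by
    intro x
    by_cases h1 : e.src = x <;> by_cases h2 : e.tgt = x <;> simp [Edge.Incident, h1, h2]
    exact e.src_ne_tgt (h1.trans h2.symm)
  simp only [hpt]
  rw [Finset.sum_add_distrib, Finset.sum_ite_eq, Finset.sum_ite_eq]
  have hs := src_mem_verts (S := S) he
  have ht := tgt_mem_verts (S := S) he
  by_cases h1 : S e.src <;> by_cases h2 : S e.tgt <;> simp [h1, h2, hs, ht]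

/-- Double counting: in an even edge set, every vertex set has an even boundary count. -/
theorem even_bdryCount (C : Finset Edge) (hC : IsEvenSet C) (S : ℤ × ℤ → Prop)
    [DecidablePred S] : Even (bdryCount C S) := by
  -- total incidence count between `C` and `verts C S`, computed both ways
  have hdeg : ∀ x, deg C x = ∑ e ∈ C, (if e.Incident x then 1 else 0) := by
    intro x; rw [deg, Finset.card_filter]
  have hdouble : ∑ x ∈ verts C S, deg C x
      = ∑ e ∈ C, ((if S e.src then 1 else 0) + (if S e.tgt then 1 else 0)) := by
    simp only [hdeg]
    rw [Finset.sum_comm]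
    exact Finset.sum_congr rfl (fun e he => sum_incident_verts C S he)
  have hleft : Even (∑ x ∈ verts C S, deg C x) :=
    Finset.even_sum _ (fun x _ => hC x)
  rw [hdouble] at hleft
  -- pointwise: [S src] + [S tgt] = 2·[both] + [exactly one]
  have hpt : ∀ e ∈ C, ((if S e.src then 1 else 0) + (if S e.tgt then 1 else 0) : ℕ)
      = 2 * (if S e.src ∧ S e.tgt then 1 else 0) + (if Xor (S e.src) (S e.tgt) then 1 else 0) := by
    intro e _
    by_cases h1 : S e.src <;> by_cases h2 : S e.tgt <;> simp [h1, h2, Xor]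
  rw [Finset.sum_congr rfl hpt, Finset.sum_add_distrib, ← Finset.mul_sum] at hleft
  have hb : bdryCount C S = ∑ e ∈ C, (if Xor (S e.src) (S e.tgt) then 1 else 0) := by
    rw [bdryCount, Finset.card_filter]
  rw [hb]
  obtain ⟨k, hk⟩ := hleft
  exact ⟨k - ∑ e ∈ C, (if S e.src ∧ S e.tgt then 1 else 0), by omega⟩


/-! ## Dual steps and the column-count potential -/

/-- The primal edge crossed by the dual step from `f` to `g` (for adjacent dual vertices); `none`
if `f` and `g` are not adjacent.  With `f = (a,b)` standing for `(a+½, b+½)`: the step to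
`(a,b+1)` crosses `h a (b+1)`, to `(a,b-1)` crosses `h a b`, to `(a+1,b)` crosses `v (a+1) b`,
to `(a-1,b)` crosses `v a b` (P8 Definition 1.2 of the paper file). -/
def crossed (f g : ℤ × ℤ) : Option Edge :=
  if g = (f.1, f.2 + 1) then some (.h f.1 (f.2 + 1))
  else if g = (f.1, f.2 - 1) then some (.h f.1 f.2)
  else if g = (f.1 + 1, f.2) then some (.v (f.1 + 1) f.2)
  else if g = (f.1 - 1, f.2) then some (.v f.1 f.2)
  else none

/-- `1` if the dual step `f → g` crosses an edge of `C`, else `0`. -/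
def crossInd (C : Finset Edge) (f g : ℤ × ℤ) : ℕ :=
  match crossed f g with
  | some e => if e ∈ C then 1 else 0
  | none => 0

/-- The four possible dual steps. -/
theorem crossed_cases {f g : ℤ × ℤ} (h : (crossed f g).isSome) :
    (g = (f.1, f.2 + 1) ∧ crossed f g = some (.h f.1 (f.2 + 1))) ∨
    (g = (f.1, f.2 - 1) ∧ crossed f g = some (.h f.1 f.2)) ∨
    (g = (f.1 + 1, f.2) ∧ crossed f g = some (.v (f.1 + 1) f.2)) ∨
    (g = (f.1 - 1, f.2) ∧ crossed f g = some (.v f.1 f.2)) := by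
  unfold crossed at h ⊢
  split_ifs at h ⊢ with h1 h2 h3 h4 <;> simp_all

/-- The horizontal edge `e` lies in the column `a` (between `x = a` and `x = a+1`) at height `≤ b`. -/
def colBelow (a b : ℤ) : Edge → Prop
  | .h i y => i = a ∧ y ≤ b
  | .v _ _ => False

/-- `colBelow a b` is decidable (by cases on the edge). -/
instance (a b : ℤ) : DecidablePred (colBelow a b) := fun e => by
  cases e with
  | h i y => exact inferInstanceAs (Decidable (i = a ∧ y ≤ b))
  | v i y => exact inferInstanceAs (Decidable False)

/-- The column count below the dual vertex `f = (a,b)`: the number of edges `h a y`, `y ≤ b`, in `C`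
(the potential `w(f)` of the paper file). -/
def colCount (C : Finset Edge) (f : ℤ × ℤ) : ℕ := (C.filter (colBelow f.1 f.2)).card

/-- The half-column `{(c, y) : y ≤ b}`. -/
def halfCol (c b : ℤ) (x : ℤ × ℤ) : Prop := x.1 = c ∧ x.2 ≤ b

/-- Membership in a half-column is decidable. -/
instance (c b : ℤ) : DecidablePred (halfCol c b) := fun x =>
  inferInstanceAs (Decidable (x.1 = c ∧ x.2 ≤ b))

/-- Going up one step adds the indicator of the crossed horizontal edge to the column count. -/
theorem colCount_up (C : Finset Edge) (a b : ℤ) :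
    colCount C (a, b + 1) = colCount C (a, b) + (if Edge.h a (b + 1) ∈ C then 1 else 0) := by
  have hlast : (if Edge.h a (b + 1) ∈ C then (1 : ℕ) else 0)
      = ∑ e ∈ C, (if e = Edge.h a (b + 1) then 1 else 0) := by
    rw [Finset.sum_ite_eq']
  rw [colCount, colCount, Finset.card_filter, Finset.card_filter, hlast, ← Finset.sum_add_distrib]
  refine Finset.sum_congr rfl (fun e _ => ?_)
  cases e with
  | h i y =>
    simp only [colBelow, Edge.h.injEq]
    split_ifs <;> omega
  | v i y =>
    simp only [colBelow, reduceCtorEq]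
    simp

/-- The edges with exactly one endpoint in the half-column `{(c,y) : y ≤ b}` are the horizontal
edges `h (c-1) y`, `h c y` with `y ≤ b` and the vertical edge `v c b`. -/
theorem bdryCount_halfCol (C : Finset Edge) (c b : ℤ) :
    bdryCount C (halfCol c b)
      = colCount C (c - 1, b) + colCount C (c, b) + (if Edge.v c b ∈ C then 1 else 0) := by
  have hlast : (if Edge.v c b ∈ C then (1 : ℕ) else 0)
      = ∑ e ∈ C, (if e = Edge.v c b then 1 else 0) := by
    rw [Finset.sum_ite_eq']
  rw [bdryCount, colCount, colCount, Finset.card_filter, Finset.card_filter, Finset.card_filter,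
    hlast, ← Finset.sum_add_distrib, ← Finset.sum_add_distrib]
  refine Finset.sum_congr rfl (fun e _ => ?_)
  cases e with
  | h i y =>
    simp only [halfCol, colBelow, Edge.src, Edge.tgt, Xor, reduceCtorEq, if_false, add_zero]
    split_ifs <;> omega
  | v i y =>
    simp only [halfCol, colBelow, Edge.src, Edge.tgt, Xor, Edge.v.injEq, if_false, zero_add]
    split_ifs <;> omega

/-- The local identity (★) of the paper file: across any dual step, the column counts at the two
ends and the crossing indicator sum to an even number. -/
theorem star (C : Finset Edge) (hC : IsEvenSet C) (f g : ℤ × ℤ) (hfg : (crossed f g).isSome) :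
    Even (colCount C f + colCount C g + crossInd C f g) := by
  obtain ⟨a, b⟩ := f
  rcases crossed_cases hfg with ⟨hg, hc⟩ | ⟨hg, hc⟩ | ⟨hg, hc⟩ | ⟨hg, hc⟩ <;>
    subst hg <;> simp only [crossInd, hc] <;> simp only at *
  · -- up: crosses `h a (b+1)`
    rw [colCount_up]
    exact ⟨colCount C (a, b) + (if Edge.h a (b + 1) ∈ C then 1 else 0), by ring⟩
  · -- down: crosses `h a b`
    have h := colCount_up C a (b - 1)
    rw [sub_add_cancel] at h
    rw [h]
    exact ⟨colCount C (a, b - 1) + (if Edge.h a b ∈ C then 1 else 0), by ring⟩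
  · -- right: crosses `v (a+1) b`
    have h := bdryCount_halfCol C (a + 1) b
    rw [add_sub_cancel_right] at h
    rw [← h]
    exact even_bdryCount C hC _
  · -- left: crosses `v a b`
    have h := bdryCount_halfCol C a b
    rw [add_comm (colCount C (a, b)) (colCount C (a - 1, b)), ← h]
    exact even_bdryCount C hC _

/-! ## Walks and the parity lemma -/

/-- The crossing count of a list of dual vertices along its consecutive steps. -/
def crossCount (C : Finset Edge) : List (ℤ × ℤ) → ℕ
  | [] => 0
  | [_] => 0
  | f :: g :: rest => crossInd C f g + crossCount C (g :: rest)

/-- A dual walk: consecutive entries are adjacent dual vertices. -/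
def IsWalk : List (ℤ × ℤ) → Prop
  | [] => True
  | [_] => True
  | f :: g :: rest => (crossed f g).isSome ∧ IsWalk (g :: rest)

/-- The last vertex of the walk `f :: L`. -/
def lastOf : ℤ × ℤ → List (ℤ × ℤ) → ℤ × ℤ
  | f, [] => f
  | _, g :: rest => lastOf g rest

/-- Telescoping: along any dual walk, the crossing count plus the column counts at the two ends is
even. -/
theorem even_crossCount_add (C : Finset Edge) (hC : IsEvenSet C) :
    ∀ (L : List (ℤ × ℤ)) (f : ℤ × ℤ), IsWalk (f :: L) →
      Even (crossCount C (f :: L) + colCount C f + colCount C (lastOf f L)) := by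
  intro L
  induction L with
  | nil =>
    intro f _
    simp only [crossCount, lastOf, zero_add]
    exact ⟨colCount C f, rfl⟩
  | cons g rest ih =>
    intro f hw
    obtain ⟨hfg, hw'⟩ := hw
    obtain ⟨k1, hk1⟩ := ih g hw'
    obtain ⟨k2, hk2⟩ := star C hC f g hfg
    simp only [crossCount, lastOf] at hk1 ⊢
    exact ⟨k1 + k2 - colCount C g, by omega⟩

/-- **The parity lemma** (P9 Lemma 2.1): a closed dual walk crosses an even edge set an even
number of times. -/
theorem parity_closed_walk (C : Finset Edge) (hC : IsEvenSet C) (f : ℤ × ℤ) (L : List (ℤ × ℤ))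
    (hw : IsWalk (f :: L)) (hclosed : lastOf f L = f) : Even (crossCount C (f :: L)) := by
  obtain ⟨k, hk⟩ := even_crossCount_add C hC L f hw
  rw [hclosed] at hk
  exact ⟨k - colCount C f, by omega⟩

end Summit.Ventures.PercRepro0.Parity
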